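import Literature.NumberTheory.LFunctions.ZetaGapRecordsRH
import Literature.NumberTheory.LFunctions.ChebyshevPsiLogPowerError
import Mathlib.NumberTheory.AbelSummation
import Mathlib.NumberTheory.Chebyshev
import Mathlib.Analysis.SpecialFunctions.Trigonometric.Bounds
import HarnessLib

/-!
# Inoue–Kobayashi–Toma 2025, Theorem 3 — PROVED: the limitation inequality for the
# Montgomery–Odlyzko bilinear form

LABEL (cell `rh-crit`, corpus C5 `ah`): **NOT RH-BEARING.** This module proves an RH-FREE,
UNCONDITIONAL finite inequality about a prime-weighted bilinear form (a no-go bound for ONE method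
of detecting small/large gaps between zeta zeros). bears_on: LADDER-RH §4 HELD «conditional bridges:
exceptional zero ⇒ …». WHAT THIS IS NOT: a claim about RH, about the Alternative Hypothesis or about
the actual gaps between zeros of `ζ`; no declaration here is progress toward RH. Nothing here bears
on the truth of RH.

Topic `Literature/NumberTheory/LFunctions` (namespace `Literature.NumberTheory.LFunctions`; the
internal steps live in the sub-namespace `IKT3` as `private` theorems). PROOF-ONLY module: no `def`,
no new named fact; it DISCHARGES the named fact
`Literature.NumberTheory.LFunctions.inoueKobayashiToma2025_theorem3` of `ZetaGapRecordsRH.lean`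
(typed there AS PRINTED, with `InoueKobayashiToma2025.moForm` and `InoueKobayashiToma2025.phi`) by
`inoueKobayashiToma2025_theorem3_holds`.

## Source and statement

S. Inoue, H. Kobayashi, Y. Toma, *Explicit extreme values of the argument of the Riemann
zeta-function* (in short intervals), arXiv:2510.14309 = Math. Proc. Cambridge Philos. Soc. (2026),
doi:10.1017/s0305004126102060 [InoueKobayashiToma2025]; held text `paper:arxiv-2510.14309`,
statement p. 4 (chunk p0004:L13–31), proof = §6 «Proof of (LGZMO)» (chunk p0011), one page:

"**Theorem 3.** Let `f` be an arithmetic function not identically zero, let `L` be large, and let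
`h > 0`. For any `W > 0`, we have
`|Re (2/π) Σ_{km ≤ L} Λ(k)/(√k log k) · sin((h/2) log k) f(m) f̄(km)| / Σ_{n ≤ L} |f(n)|²
 ≤ max_{1 ≤ l ≤ L} { (√W/2) φ((h/2π) log(L/l)) + h log l/(π√W) } + O(h)`.
Here `φ(x) = ∫₀^x (sin(πu)/πu)² du`."

## The printed proof (§6) and how it is followed here

* (P1) «we adapt Soundararajan's method, which uses an inequality similar to
  `2|f(m) sin((h/2) log k) f(km)| ≤ |f(m)|² sin²((h/2) log k) g(k) + |f(km)|²/g(k)`» with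
  `g(n) = √W/(h √n log n)` — `IKT3.two_mul_term_le` (weighted AM–GM, termwise).
* (P2) the reindexing `km = n` and `Σ_{k ∣ n} Λ(k) = log n` (Mathlib `vonMangoldt_sum`), giving
  `(1/π) Σ_{n ≤ L} |f(n)|² ( √W Σ_{p^a ≤ L/n} sin²((h/2) log p^a)/(a² p^a h log p) + h log n/√W )`
  — `IKT3.sum_divisors_reindex`, `IKT3.abs_re_moForm_le` (the prime-power sum is written as
  `Σ_{k ≤ L/n} Λ(k) sin²((h/2)log k)/(h k log² k)`, the same thing).
* (P3) «Routine calculations using the prime number theorem and partial summation show that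
  `Σ_{p^a ≤ L/n} … = (π/2) φ((h/2π) log(L/n)) + O(h)`» — `IKT3.exists_primeSum_le`, the UPPER bound
  (all that the theorem uses), uniformly in `h > 0` and real `x ≥ 1`, with an ABSOLUTE constant:
  Abel summation (Mathlib `sum_mul_eq_sub_integral_mul₁`) against `ψ = Chebyshev.psi`,
  `ψ(x) = x + O(x/log² x)` from the TREE's unconditional
  `PsiLogPower.chebyshevPsi_sub_self_isBigO_div_logPow` (`ChebyshevPsiLogPowerError.lean`) plus
  Chebyshev's bound on the initial range, the elementary bounds `G_h(t) ≤ h/(4t)` and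
  `|G_h'(t)| ≤ h(log t + 4)/(4t² log t)` for `G_h(t) = sin²((h/2)log t)/(h t log² t)` (from
  `|sin y| ≤ |y|`), the exact evaluation `∫_a^b G_h = (π/2)(φ((h/2π)log b) − φ((h/2π)log a))`
  (substitution `u = (h/2π) log t`, done as the FTC for `φ ∘ ((h/2π) log)`), and the antiderivative
  `−1/(4 log t) − 1/(2 log² t)` of `(log t + 4)/(4t log³ t)` for the remainder integral.
* (P4) «Therefore … ≤ (max_{n ≤ L} {…} + O(h)) Σ|f(n)|²» — the maximum over `l = n ∈ [1, L]` is
  taken with `Finset.exists_max_image`; the typed fact renders `max_{1 ≤ l ≤ L}` as «for some real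
  `l ∈ [1, L]`», which the maximising integer `n` witnesses.

Quantifiers of the typed fact: `∀ W > 0, ∃ C, ∃ L₀, ∀ L ≥ L₀, ∀ h > 0, ∀ f` (non-zero on `[1, L]`),
`∃ l ∈ [1, L]`, bound `+ C·h`. Here `C = √W·C₁/π` with `C₁` the absolute constant of (P3) (the
paper's `O(h)` «arises multiplied by `√W/π`») and `L₀ = 1`. No step deviates from the printed
argument; the only choice made is to prove the one-sided (upper) form of (P3), which is what §6 uses.

## References

* [InoueKobayashiToma2025] Inoue–Kobayashi–Toma, arXiv:2510.14309, MPCPS 2026, Theorem 3 and §6.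
* [MontgomeryVaughan2007] for the prime number theorem with remainder (via the tree file
  `ChebyshevPsiLogPowerError.lean`).
-/

noncomputable section

open Real Filter MeasureTheory Set Finset
open scoped Topology Chebyshev ArithmeticFunction.vonMangoldt

namespace Literature.NumberTheory.LFunctions

namespace IKT3

/-- PNT remainder in the form used here: `|ψ(t) − t| ≤ C_R · t / log² t` for all `t ≥ 2`
(from the tree's `chebyshevPsi_sub_self_isBigO_div_logPow 2` and Chebyshev's bound on the initial
range). [folklore] -/
private theorem exists_abs_psi_sub_self_le :
    ∃ C : ℝ, 0 ≤ C ∧ ∀ t : ℝ, 2 ≤ t → |ψ t - t| ≤ C * t / Real.log t ^ 2 := by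
  obtain ⟨C₀, hC₀⟩ := (PsiLogPower.chebyshevPsi_sub_self_isBigO_div_logPow 2).bound
  obtain ⟨T₀, hT₀⟩ := Filter.eventually_atTop.mp hC₀
  set T : ℝ := max T₀ 2 with hT
  have hT2 : 2 ≤ T := le_max_right _ _
  have hlog2 : 0 < Real.log 2 := Real.log_pos one_lt_two
  refine ⟨max C₀ 0 + (Real.log 4 + 5) * Real.log T ^ 2, by positivity, fun t ht => ?_⟩
  have ht0 : 0 < t := by linarith
  have hlt : 0 < Real.log t := Real.log_pos (by linarith)
  have hlt2 : 0 < Real.log t ^ 2 := by positivity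
  rcases le_or_gt T t with hTt | hTt
  · -- large range: the `IsBigO` bound
    have h1 := hT₀ t ((le_max_left _ _).trans hTt)
    have hrpow : t / Real.log t ^ (2 : ℝ) = t / Real.log t ^ 2 := by
      rw [show (2 : ℝ) = ((2 : ℕ) : ℝ) by norm_num, Real.rpow_natCast]
    rw [hrpow, Real.norm_eq_abs, Real.norm_of_nonneg (by positivity)] at h1
    calc |ψ t - t| ≤ C₀ * (t / Real.log t ^ 2) := h1
      _ ≤ max C₀ 0 * (t / Real.log t ^ 2) := by gcongr; exact le_max_left _ _
      _ ≤ (max C₀ 0 + (Real.log 4 + 5) * Real.log T ^ 2) * (t / Real.log t ^ 2) := by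
          gcongr; nlinarith [sq_nonneg (Real.log T), Real.log_nonneg (show (1:ℝ) ≤ 4 by norm_num)]
      _ = _ := by ring
  · -- initial range `2 ≤ t < T`: Chebyshev
    have hψ : ψ t ≤ (Real.log 4 + 4) * t := Chebyshev.psi_le_const_mul_self ht0.le
    have hψ0 : 0 ≤ ψ t := Chebyshev.psi_nonneg t
    have habs : |ψ t - t| ≤ (Real.log 4 + 5) * t := by
      rw [abs_le]; constructor <;> nlinarith [Real.log_nonneg (show (1:ℝ) ≤ 4 by norm_num)]
    have hlogT : Real.log t ≤ Real.log T := Real.log_le_log ht0 hTt.le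
    have hlogT2 : Real.log t ^ 2 ≤ Real.log T ^ 2 := by gcongr
    calc |ψ t - t| ≤ (Real.log 4 + 5) * t := habs
      _ = (Real.log 4 + 5) * Real.log t ^ 2 * (t / Real.log t ^ 2) := by field_simp
      _ ≤ (Real.log 4 + 5) * Real.log T ^ 2 * (t / Real.log t ^ 2) := by gcongr
      _ ≤ (max C₀ 0 + (Real.log 4 + 5) * Real.log T ^ 2) * (t / Real.log t ^ 2) := by
          gcongr; linarith [le_max_right C₀ 0]
      _ = _ := by ring

/-- `G_h(t) = sin²((h/2) log t)/(h t log² t) ≤ h/(4t)` for `t > 0`, `h > 0` (from `sin² y ≤ y²`).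
[folklore] -/
private theorem G_le {h t : ℝ} (hh : 0 < h) (ht : 0 < t) :
    Real.sin (h / 2 * Real.log t) ^ 2 / (h * t * Real.log t ^ 2) ≤ h / (4 * t) := by
  rcases eq_or_ne (Real.log t) 0 with hl | hl
  · simp [hl]; positivity
  have hl2 : 0 < Real.log t ^ 2 := by positivity
  rw [div_le_div_iff₀ (by positivity) (by positivity)]
  have := Real.sin_sq_le_sq (x := h / 2 * Real.log t)
  nlinarith [this, mul_pos hh ht]

/-- `G_h ≥ 0`. [folklore] -/
private theorem G_nonneg {h t : ℝ} (hh : 0 < h) (ht : 0 < t) :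
    0 ≤ Real.sin (h / 2 * Real.log t) ^ 2 / (h * t * Real.log t ^ 2) := by
  positivity


/-- The derivative of `G_h(t) = sin²((h/2) log t)/(h t log² t)` at `t > 1` (quotient rule, raw form).
[folklore] -/
private theorem hasDerivAt_G {h t : ℝ} (hh : h ≠ 0) (ht : 1 < t) :
    HasDerivAt (fun t => Real.sin (h / 2 * Real.log t) ^ 2 / (h * t * Real.log t ^ 2))
      ((h * Real.sin (h / 2 * Real.log t) * Real.cos (h / 2 * Real.log t) / t
            * (h * t * Real.log t ^ 2)
          - Real.sin (h / 2 * Real.log t) ^ 2 * (h * Real.log t ^ 2 + 2 * h * Real.log t))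
        / (h * t * Real.log t ^ 2) ^ 2) t := by
  have ht0 : 0 < t := by linarith
  have hl : Real.log t ≠ 0 := (Real.log_pos ht).ne'
  have hu : HasDerivAt (fun t => h / 2 * Real.log t) (h / 2 * t⁻¹) t :=
    (Real.hasDerivAt_log ht0.ne').const_mul _
  have hnum : HasDerivAt (fun t => Real.sin (h / 2 * Real.log t) ^ 2)
      ((2 : ℕ) * Real.sin (h / 2 * Real.log t) ^ (2 - 1)
        * (Real.cos (h / 2 * Real.log t) * (h / 2 * t⁻¹))) t := hu.sin.pow 2
  have h1 : HasDerivAt (fun t => h * t) (h * 1) t := (hasDerivAt_id t).const_mul h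
  have h2 : HasDerivAt (fun t => Real.log t ^ 2) ((2 : ℕ) * Real.log t ^ (2 - 1) * t⁻¹) t :=
    (Real.hasDerivAt_log ht0.ne').pow 2
  have hden : HasDerivAt (fun t => h * t * Real.log t ^ 2)
      (h * 1 * Real.log t ^ 2 + h * t * ((2 : ℕ) * Real.log t ^ (2 - 1) * t⁻¹)) t := h1.mul h2
  have hne : h * t * Real.log t ^ 2 ≠ 0 := by positivity
  refine (hnum.div hden hne).congr_deriv ?_
  push_cast
  field_simp

/-- Bound for that derivative: `|G_h'(t)| ≤ h (log t + 4)/(4 t² log t)` for `t ≥ 2`, `h > 0`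
(from `|sin y| ≤ |y|`, `|cos| ≤ 1`). [folklore] -/
private theorem abs_derivG_le {h t : ℝ} (hh : 0 < h) (ht : 2 ≤ t) :
    |(h * Real.sin (h / 2 * Real.log t) * Real.cos (h / 2 * Real.log t) / t
            * (h * t * Real.log t ^ 2)
          - Real.sin (h / 2 * Real.log t) ^ 2 * (h * Real.log t ^ 2 + 2 * h * Real.log t))
        / (h * t * Real.log t ^ 2) ^ 2|
      ≤ h * (Real.log t + 4) / (4 * t ^ 2 * Real.log t) := by
  have ht0 : 0 < t := by linarith
  have hl : 0 < Real.log t := Real.log_pos (by linarith)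
  set l := Real.log t with hldef
  set s := Real.sin (h / 2 * l) with hsdef
  set c := Real.cos (h / 2 * l) with hcdef
  have hu0 : 0 ≤ h / 2 * l := by positivity
  have hs : |s| ≤ h / 2 * l := by
    simpa [abs_of_nonneg hu0] using Real.abs_sin_le_abs (x := h / 2 * l)
  have hc : |c| ≤ 1 := Real.abs_cos_le_one _
  have hs2 : s ^ 2 ≤ (h / 2 * l) ^ 2 := by
    simpa using Real.sin_sq_le_sq (x := h / 2 * l)
  have hden : 0 < (h * t * l ^ 2) ^ 2 := by positivity
  rw [abs_div, abs_of_pos hden, div_le_div_iff₀ hden (by positivity)]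
  have hn1 : |h * s * c / t * (h * t * l ^ 2)| ≤ h ^ 3 * l ^ 3 / 2 := by
    have : h * s * c / t * (h * t * l ^ 2) = h ^ 2 * l ^ 2 * (s * c) := by
      field_simp
    rw [this, abs_mul, abs_of_pos (by positivity : 0 < h ^ 2 * l ^ 2), abs_mul]
    have hsc : |s| * |c| ≤ h / 2 * l * 1 :=
      mul_le_mul hs hc (abs_nonneg _) (by positivity)
    nlinarith [hsc, show 0 < h ^ 2 * l ^ 2 by positivity]
  have hn2 : |s ^ 2 * (h * l ^ 2 + 2 * h * l)| ≤ (h / 2 * l) ^ 2 * (h * l ^ 2 + 2 * h * l) := by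
    rw [abs_of_nonneg (by positivity)]
    exact mul_le_mul_of_nonneg_right hs2 (by positivity)
  have htri := abs_sub (h * s * c / t * (h * t * l ^ 2)) (s ^ 2 * (h * l ^ 2 + 2 * h * l))
  have key : |h * s * c / t * (h * t * l ^ 2) - s ^ 2 * (h * l ^ 2 + 2 * h * l)|
      ≤ h ^ 3 * l ^ 3 / 2 + (h / 2 * l) ^ 2 * (h * l ^ 2 + 2 * h * l) := by linarith
  calc |h * s * c / t * (h * t * l ^ 2) - s ^ 2 * (h * l ^ 2 + 2 * h * l)| * (4 * t ^ 2 * l)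
      ≤ (h ^ 3 * l ^ 3 / 2 + (h / 2 * l) ^ 2 * (h * l ^ 2 + 2 * h * l)) * (4 * t ^ 2 * l) := by
        gcongr
    _ = h * (l + 4) * (h * t * l ^ 2) ^ 2 := by ring

/-- The sine kernel is continuous. [folklore] -/
private theorem continuous_sineKernel : Continuous sineKernel := by
  have : sineKernel = fun x => Real.sinc (π * x) := funext fun _ => rfl
  rw [this]
  exact Real.continuous_sinc.comp (continuous_const.mul continuous_id)

/-- `φ' = sineKernel²` (FTC). [folklore] -/
private theorem hasDerivAt_phi (y : ℝ) :
    HasDerivAt InoueKobayashiToma2025.phi (sineKernel y ^ 2) y := by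
  have hc : Continuous fun u => sineKernel u ^ 2 := continuous_sineKernel.pow 2
  have : InoueKobayashiToma2025.phi = fun y => ∫ u in (0 : ℝ)..y, sineKernel u ^ 2 :=
    funext fun _ => rfl
  rw [this]
  exact intervalIntegral.integral_hasDerivAt_right (hc.intervalIntegrable _ _)
    (hc.stronglyMeasurableAtFilter _ _) hc.continuousAt

/-- `φ` is monotone (its integrand is non-negative). [folklore] -/
private theorem phi_mono : Monotone InoueKobayashiToma2025.phi :=
  monotone_of_deriv_nonneg (fun y => (hasDerivAt_phi y).differentiableAt) fun y => by
    rw [(hasDerivAt_phi y).deriv]; exact sq_nonneg _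

/-- `0 ≤ φ(y) ≤ y` for `y ≥ 0` (`sineKernel² ≤ 1`). [folklore] -/
private theorem phi_nonneg {y : ℝ} (hy : 0 ≤ y) : 0 ≤ InoueKobayashiToma2025.phi y := by
  unfold InoueKobayashiToma2025.phi
  exact intervalIntegral.integral_nonneg hy fun u _ => sq_nonneg _

/-- `φ(y) ≤ y` for `y ≥ 0`. [folklore] -/
private theorem phi_le_self {y : ℝ} (hy : 0 ≤ y) : InoueKobayashiToma2025.phi y ≤ y := by
  unfold InoueKobayashiToma2025.phi
  have h1 : ∫ u in (0 : ℝ)..y, sineKernel u ^ 2 ≤ ∫ u in (0 : ℝ)..y, (1 : ℝ) := by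
    refine intervalIntegral.integral_mono_on hy
      ((continuous_sineKernel.pow 2).intervalIntegrable _ _) (by simp) fun u _ => ?_
    have := Real.abs_sinc_le_one (π * u)
    have h2 : sineKernel u ^ 2 = |Real.sinc (π * u)| ^ 2 := by rw [sq_abs]; rfl
    rw [h2]
    nlinarith [abs_nonneg (Real.sinc (π * u))]
  simpa using h1

/-- `d/dt [(π/2) φ((h/2π) log t)] = G_h(t)` for `t > 1`, `h > 0`. [folklore] -/
private theorem hasDerivAt_phi_log {h t : ℝ} (hh : 0 < h) (ht : 1 < t) :
    HasDerivAt (fun t => π / 2 * InoueKobayashiToma2025.phi (h / (2 * π) * Real.log t))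
      (Real.sin (h / 2 * Real.log t) ^ 2 / (h * t * Real.log t ^ 2)) t := by
  have ht0 : 0 < t := by linarith
  have hl : Real.log t ≠ 0 := (Real.log_pos ht).ne'
  have hin : HasDerivAt (fun t => h / (2 * π) * Real.log t) (h / (2 * π) * t⁻¹) t :=
    (Real.hasDerivAt_log ht0.ne').const_mul _
  have hcomp : HasDerivAt (fun t => π / 2 * InoueKobayashiToma2025.phi (h / (2 * π) * Real.log t))
      (π / 2 * (sineKernel (h / (2 * π) * Real.log t) ^ 2 * (h / (2 * π) * t⁻¹))) t :=
    ((hasDerivAt_phi (h / (2 * π) * Real.log t)).comp t hin).const_mul (π / 2)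
  refine hcomp.congr_deriv ?_
  have hy : π * (h / (2 * π) * Real.log t) = h / 2 * Real.log t := by
    field_simp
  have hy0 : h / 2 * Real.log t ≠ 0 := by positivity
  have hsk : sineKernel (h / (2 * π) * Real.log t)
      = Real.sin (h / 2 * Real.log t) / (h / 2 * Real.log t) := by
    show Real.sinc _ = _
    rw [hy, Real.sinc_of_ne_zero hy0]
  rw [hsk]
  field_simp

/-- `G_h` is continuous on `[a, b]` for `a > 1`. [folklore] -/
private theorem continuousOn_G {h a b : ℝ} (hh : h ≠ 0) (ha : 1 < a) :
    ContinuousOn (fun t => Real.sin (h / 2 * Real.log t) ^ 2 / (h * t * Real.log t ^ 2))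
      (Set.Icc a b) := by
  have hlog : ContinuousOn Real.log (Set.Icc a b) :=
    Real.continuousOn_log.mono fun t ht => by
      simp only [Set.mem_compl_iff, Set.mem_singleton_iff]; linarith [ht.1]
  have hnum : ContinuousOn (fun t => Real.sin (h / 2 * Real.log t) ^ 2) (Set.Icc a b) :=
    (Real.continuous_sin.comp_continuousOn (continuousOn_const.mul hlog)).pow 2
  have hden : ContinuousOn (fun t => h * t * Real.log t ^ 2) (Set.Icc a b) :=
    (continuousOn_const.mul continuousOn_id).mul (hlog.pow 2)
  refine hnum.div hden fun t ht => ?_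
  have : 0 < Real.log t := Real.log_pos (by linarith [ht.1])
  have : 0 < t := by linarith [ht.1]
  positivity

/-- `∫_a^b G_h = (π/2)(φ((h/2π) log b) − φ((h/2π) log a))` for `1 < a ≤ b`, `h > 0`. [folklore] -/
private theorem integral_G_eq {h a b : ℝ} (hh : 0 < h) (ha : 1 < a) (hab : a ≤ b) :
    ∫ t in a..b, Real.sin (h / 2 * Real.log t) ^ 2 / (h * t * Real.log t ^ 2)
      = π / 2 * InoueKobayashiToma2025.phi (h / (2 * π) * Real.log b)
        - π / 2 * InoueKobayashiToma2025.phi (h / (2 * π) * Real.log a) := by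
  refine intervalIntegral.integral_eq_sub_of_hasDerivAt
    (f := fun t => π / 2 * InoueKobayashiToma2025.phi (h / (2 * π) * Real.log t))
    (fun t ht => ?_) ?_
  · rw [Set.uIcc_of_le hab] at ht
    exact hasDerivAt_phi_log hh (by linarith [ht.1])
  · exact (continuousOn_G hh.ne' ha).intervalIntegrable_of_Icc hab

/-- The antiderivative used for the remainder integral:
`d/dt [−1/(4 log t) − 1/(2 log² t)] = (log t + 4)/(4 t log³ t)` for `t > 1`. [folklore] -/
private theorem hasDerivAt_logAntideriv {t : ℝ} (ht : 1 < t) :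
    HasDerivAt (fun t => -1 / (4 * Real.log t) - 1 / (2 * Real.log t ^ 2))
      ((Real.log t + 4) / (4 * t * Real.log t ^ 3)) t := by
  have ht0 : 0 < t := by linarith
  have hl : Real.log t ≠ 0 := (Real.log_pos ht).ne'
  have hlog := Real.hasDerivAt_log ht0.ne'
  have h1 : HasDerivAt (fun t => 4 * Real.log t) (4 * t⁻¹) t := hlog.const_mul 4
  have h2 : HasDerivAt (fun t => 2 * Real.log t ^ 2) (2 * ((2 : ℕ) * Real.log t ^ (2 - 1) * t⁻¹)) t :=
    (hlog.pow 2).const_mul 2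
  have h3 := ((hasDerivAt_const t (-1 : ℝ)).div h1 (by positivity)).sub
    ((hasDerivAt_const t (1 : ℝ)).div h2 (by positivity))
  refine h3.congr_deriv ?_
  push_cast
  field_simp
  ring

/-- Continuity of the raw derivative expression of `G_h` on `[a, b]`, `a > 1`. [folklore] -/
private theorem continuousOn_derivG {h a b : ℝ} (hh : h ≠ 0) (ha : 1 < a) :
    ContinuousOn (fun t =>
      (h * Real.sin (h / 2 * Real.log t) * Real.cos (h / 2 * Real.log t) / t
            * (h * t * Real.log t ^ 2)
          - Real.sin (h / 2 * Real.log t) ^ 2 * (h * Real.log t ^ 2 + 2 * h * Real.log t))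
        / (h * t * Real.log t ^ 2) ^ 2) (Set.Icc a b) := by
  have hlog : ContinuousOn Real.log (Set.Icc a b) :=
    Real.continuousOn_log.mono fun t ht => by
      simp only [Set.mem_compl_iff, Set.mem_singleton_iff]; linarith [ht.1]
  have hu : ContinuousOn (fun t => h / 2 * Real.log t) (Set.Icc a b) := continuousOn_const.mul hlog
  have hsin : ContinuousOn (fun t => Real.sin (h / 2 * Real.log t)) (Set.Icc a b) :=
    Real.continuous_sin.comp_continuousOn hu
  have hcos : ContinuousOn (fun t => Real.cos (h / 2 * Real.log t)) (Set.Icc a b) :=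
    Real.continuous_cos.comp_continuousOn hu
  have hden : ContinuousOn (fun t => h * t * Real.log t ^ 2) (Set.Icc a b) :=
    (continuousOn_const.mul continuousOn_id).mul (hlog.pow 2)
  have ht0 : ∀ t ∈ Set.Icc a b, (t : ℝ) ≠ 0 := fun t ht => by linarith [ht.1]
  refine ContinuousOn.div ?_ (hden.pow 2) fun t ht => ?_
  · refine ContinuousOn.sub ?_ ?_
    · exact (((continuousOn_const.mul hsin).mul hcos).div continuousOn_id ht0).mul hden
    · exact (hsin.pow 2).mul ((continuousOn_const.mul (hlog.pow 2)).add
        (continuousOn_const.mul hlog))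
  · have : 0 < Real.log t := Real.log_pos (by linarith [ht.1])
    have : 0 < t := by linarith [ht.1]
    positivity

/-- **(P3)** the prime-sum estimate of IKT §6 («routine calculations using the prime number
theorem and partial summation»), upper-bound form, uniform in `h > 0` and `x ≥ 1`:
`Σ_{k ≤ x} Λ(k) sin²((h/2) log k)/(h k log² k) ≤ (π/2) φ((h/2π) log x) + C₁ h`. [folklore] -/
private theorem exists_primeSum_le :
    ∃ C₁ : ℝ, 0 ≤ C₁ ∧ ∀ h : ℝ, 0 < h → ∀ x : ℝ, 1 ≤ x →
      ∑ k ∈ Finset.Icc 0 ⌊x⌋₊,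
          Real.sin (h / 2 * Real.log k) ^ 2 / (h * k * Real.log k ^ 2) * Λ k
        ≤ π / 2 * InoueKobayashiToma2025.phi (h / (2 * π) * Real.log x) + C₁ * h := by
  obtain ⟨C, hC0, hC⟩ := exists_abs_psi_sub_self_le
  refine ⟨4 * C + 1, by positivity, fun h hh x hx => ?_⟩
  have hx0 : 0 < x := by linarith
  have hphi0 : 0 ≤ InoueKobayashiToma2025.phi (h / (2 * π) * Real.log x) :=
    phi_nonneg (by have := Real.log_nonneg hx; positivity)
  rcases lt_or_ge x 2 with hx2 | hx2
  · -- `x < 2`: the sum vanishes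
    have hfl : ⌊x⌋₊ < 2 := (Nat.floor_lt hx0.le).mpr (by exact_mod_cast hx2)
    have hsum : ∑ k ∈ Finset.Icc 0 ⌊x⌋₊,
        Real.sin (h / 2 * Real.log k) ^ 2 / (h * k * Real.log k ^ 2) * Λ k = 0 := by
      refine Finset.sum_eq_zero fun k hk => ?_
      have hk : k < 2 := lt_of_le_of_lt (Finset.mem_Icc.mp hk).2 hfl
      interval_cases k <;> simp [ArithmeticFunction.vonMangoldt_apply_one]
    rw [hsum]; positivity
  -- `x ≥ 2`: Abel summation against `ψ`
  set G : ℝ → ℝ := fun t => Real.sin (h / 2 * Real.log t) ^ 2 / (h * t * Real.log t ^ 2)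
    with hGdef
  set D : ℝ → ℝ := fun t =>
      (h * Real.sin (h / 2 * Real.log t) * Real.cos (h / 2 * Real.log t) / t
            * (h * t * Real.log t ^ 2)
          - Real.sin (h / 2 * Real.log t) ^ 2 * (h * Real.log t ^ 2 + 2 * h * Real.log t))
        / (h * t * Real.log t ^ 2) ^ 2 with hDdef
  have hderiv : ∀ t ∈ Set.Icc 2 x, HasDerivAt G (D t) t := fun t ht =>
    hasDerivAt_G hh.ne' (by linarith [ht.1])
  have hdiff : ∀ t ∈ Set.Icc 2 x, DifferentiableAt ℝ G t := fun t ht =>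
    (hderiv t ht).differentiableAt
  have hderiv_eq : ∀ t ∈ Set.Icc 2 x, deriv G t = D t := fun t ht => (hderiv t ht).deriv
  have hDcont : ContinuousOn D (Set.Icc 2 x) := continuousOn_derivG hh.ne' one_lt_two
  have hGcont : ContinuousOn G (Set.Icc 2 x) := continuousOn_G hh.ne' one_lt_two
  have hDint : IntegrableOn D (Set.Icc 2 x) := hDcont.integrableOn_Icc
  have hint : IntegrableOn (deriv G) (Set.Icc 2 x) :=
    hDint.congr_fun (fun t ht => (hderiv_eq t ht).symm) measurableSet_Icc
  have habel := sum_mul_eq_sub_integral_mul₁ (fun k => (Λ k : ℝ)) (by simp)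
    (by simp [ArithmeticFunction.vonMangoldt_apply_one]) x hdiff hint
  simp only [← Chebyshev.psi_eq_sum_Icc] at habel
  -- the integral in `habel` as an interval integral of `D ψ`
  have hI : ∫ t in Set.Ioc 2 x, deriv G t * ψ t = ∫ t in (2 : ℝ)..x, D t * ψ t := by
    rw [intervalIntegral.integral_of_le hx2]
    refine setIntegral_congr_fun measurableSet_Ioc fun t ht => ?_
    simp only [hderiv_eq t ⟨ht.1.le, ht.2⟩]
  -- integrability of `D t * t`, `D t * ψ t` on `[2, x]`
  have hDt : IntervalIntegrable (fun t => D t * t) volume 2 x :=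
    (hDcont.mul continuousOn_id).intervalIntegrable_of_Icc hx2
  have hDψ : IntervalIntegrable (fun t => D t * ψ t) volume 2 x := by
    rw [intervalIntegrable_iff_integrableOn_Icc_of_le hx2]
    have := integrableOn_mul_sum_Icc (fun k => (Λ k : ℝ)) (m := 0) zero_le_two hDint (b := x)
    simpa only [← Chebyshev.psi_eq_sum_Icc] using this
  -- integration by parts for the smooth part
  have hparts : ∫ t in (2 : ℝ)..x, G t = G x * x - G 2 * 2 - ∫ t in (2 : ℝ)..x, D t * t := by
    have := intervalIntegral.integral_mul_deriv_eq_deriv_mul (u := G) (v := fun t => t)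
      (u' := D) (v' := fun _ => (1 : ℝ))
      (fun t ht => hderiv t (by rwa [Set.uIcc_of_le hx2] at ht))
      (fun t _ => hasDerivAt_id t) (hDcont.intervalIntegrable_of_Icc hx2)
      intervalIntegrable_const
    simpa using this
  -- split `∫ D ψ = ∫ D·t + ∫ D·(ψ − t)`
  have hsplit : ∫ t in (2 : ℝ)..x, D t * ψ t
      = (∫ t in (2 : ℝ)..x, D t * t) + ∫ t in (2 : ℝ)..x, D t * (ψ t - t) := by
    rw [← intervalIntegral.integral_add hDt (by simpa [mul_sub] using hDψ.sub hDt)]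
    congr 1; funext t; ring
  -- (i) the smooth main term
  have hmain : ∫ t in (2 : ℝ)..x, G t ≤ π / 2 * InoueKobayashiToma2025.phi (h / (2 * π) * Real.log x) := by
    rw [hGdef, integral_G_eq hh one_lt_two hx2]
    have : 0 ≤ InoueKobayashiToma2025.phi (h / (2 * π) * Real.log 2) :=
      phi_nonneg (by have := Real.log_nonneg (show (1:ℝ) ≤ 2 by norm_num); positivity)
    nlinarith [Real.pi_pos]
  -- (ii) the boundary terms
  have hlog2 : (1 : ℝ) / 2 < Real.log 2 := by
    have := Real.log_two_gt_d9; linarith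
  have hGx : G x * (ψ x - x) ≤ C * h := by
    have hG := G_le hh hx0
    have hG0 := G_nonneg hh hx0
    have hR := hC x hx2
    have hlx : Real.log 2 ≤ Real.log x := Real.log_le_log (by norm_num) hx2
    have hlx2 : (1 : ℝ) / 4 ≤ Real.log x ^ 2 := by nlinarith
    calc G x * (ψ x - x) ≤ G x * |ψ x - x| :=
          mul_le_mul_of_nonneg_left (le_abs_self _) hG0
      _ ≤ h / (4 * x) * (C * x / Real.log x ^ 2) := mul_le_mul hG hR (abs_nonneg _) (by positivity)
      _ = C * h / (4 * Real.log x ^ 2) := by field_simp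
      _ ≤ C * h / (4 * (1 / 4)) := by gcongr
      _ = C * h := by ring
  have hG2 : G 2 * 2 ≤ h / 4 := by
    have := G_le hh (show (0:ℝ) < 2 by norm_num)
    simp only [hGdef] at this ⊢
    linarith
  -- (iii) the remainder integral
  have hrem : |∫ t in (2 : ℝ)..x, D t * (ψ t - t)| ≤ 5 / 2 * C * h := by
    have hbound : ∀ t ∈ Set.Ioc 2 x, ‖D t * (ψ t - t)‖
        ≤ C * h * ((Real.log t + 4) / (4 * t * Real.log t ^ 3)) := by
      intro t ht
      have ht2 : 2 ≤ t := ht.1.le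
      have ht0 : 0 < t := by linarith
      have hlt : 0 < Real.log t := Real.log_pos (by linarith)
      rw [Real.norm_eq_abs, abs_mul]
      have h1 := abs_derivG_le hh ht2
      have h2 := hC t ht2
      calc |D t| * |ψ t - t|
          ≤ h * (Real.log t + 4) / (4 * t ^ 2 * Real.log t) * (C * t / Real.log t ^ 2) :=
            mul_le_mul h1 h2 (abs_nonneg _) (by positivity)
        _ = C * h * ((Real.log t + 4) / (4 * t * Real.log t ^ 3)) := by field_simp
    have hFcont : ContinuousOn (fun t => (Real.log t + 4) / (4 * t * Real.log t ^ 3))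
        (Set.Icc 2 x) := by
      have hlog : ContinuousOn Real.log (Set.Icc 2 x) :=
        Real.continuousOn_log.mono fun t ht => by
          simp only [Set.mem_compl_iff, Set.mem_singleton_iff]; linarith [ht.1]
      refine (hlog.add continuousOn_const).div
        ((continuousOn_const.mul continuousOn_id).mul (hlog.pow 3)) fun t ht => ?_
      have : 0 < Real.log t := Real.log_pos (by linarith [ht.1])
      have : 0 < t := by linarith [ht.1]
      positivity
    have hnorm := intervalIntegral.norm_integral_le_of_norm_le (μ := volume) hx2
      (Filter.Eventually.of_forall hbound)
      ((hFcont.intervalIntegrable_of_Icc hx2).const_mul (C * h))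
    rw [Real.norm_eq_abs] at hnorm
    have hF : ∫ t in (2 : ℝ)..x, (Real.log t + 4) / (4 * t * Real.log t ^ 3)
        = (-1 / (4 * Real.log x) - 1 / (2 * Real.log x ^ 2))
          - (-1 / (4 * Real.log 2) - 1 / (2 * Real.log 2 ^ 2)) := by
      refine intervalIntegral.integral_eq_sub_of_hasDerivAt
        (f := fun t => -1 / (4 * Real.log t) - 1 / (2 * Real.log t ^ 2)) (fun t ht => ?_)
        (hFcont.intervalIntegrable_of_Icc hx2)
      rw [Set.uIcc_of_le hx2] at ht
      exact hasDerivAt_logAntideriv (by linarith [ht.1])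
    have hlx : 0 < Real.log x := Real.log_pos (by linarith)
    have hval : ∫ t in (2 : ℝ)..x, (Real.log t + 4) / (4 * t * Real.log t ^ 3) ≤ 5 / 2 := by
      rw [hF, neg_div, neg_div]
      have h1 : 0 ≤ 1 / (4 * Real.log x) := by positivity
      have h2 : 0 ≤ 1 / (2 * Real.log x ^ 2) := by positivity
      have h3 : 1 / (4 * Real.log 2) ≤ 1 / 2 := by
        rw [div_le_div_iff₀ (by positivity) (by norm_num)]; linarith
      have h4 : 1 / (2 * Real.log 2 ^ 2) ≤ 2 := by
        rw [div_le_iff₀ (by positivity)]; nlinarith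
      linarith
    calc |∫ t in (2 : ℝ)..x, D t * (ψ t - t)|
        ≤ ∫ t in (2 : ℝ)..x, C * h * ((Real.log t + 4) / (4 * t * Real.log t ^ 3)) := hnorm
      _ = C * h * ∫ t in (2 : ℝ)..x, (Real.log t + 4) / (4 * t * Real.log t ^ 3) :=
          intervalIntegral.integral_const_mul _ _
      _ ≤ C * h * (5 / 2) := by gcongr
      _ = 5 / 2 * C * h := by ring
  -- assemble
  have hid : ∑ k ∈ Finset.Icc 0 ⌊x⌋₊, G k * Λ k
      = (∫ t in (2 : ℝ)..x, G t) + G x * (ψ x - x) + G 2 * 2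
        - ∫ t in (2 : ℝ)..x, D t * (ψ t - t) := by
    rw [habel, hI, hsplit, hparts]; ring
  have habs := neg_abs_le (∫ t in (2 : ℝ)..x, D t * (ψ t - t))
  calc ∑ k ∈ Finset.Icc 0 ⌊x⌋₊, G k * Λ k
      = (∫ t in (2 : ℝ)..x, G t) + G x * (ψ x - x) + G 2 * 2
        - ∫ t in (2 : ℝ)..x, D t * (ψ t - t) := hid
    _ ≤ π / 2 * InoueKobayashiToma2025.phi (h / (2 * π) * Real.log x)
        + C * h + h / 4 + 5 / 2 * C * h := by linarith [le_abs_self (∫ t in (2 : ℝ)..x, D t * (ψ t - t))]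
    _ ≤ π / 2 * InoueKobayashiToma2025.phi (h / (2 * π) * Real.log x) + (4 * C + 1) * h := by
        nlinarith

/-! ### (P1)–(P2): the finite-sum algebra -/

/-- Hyperbola reindexing: `Σ_{n ≤ L} Σ_{k ∣ n} F(k, n/k) = Σ_{m ≤ L} Σ_{k ≤ L/m} F(k, m)`. [folklore] -/
private theorem sum_divisors_reindex (L : ℕ) (F : ℕ → ℕ → ℝ) :
    ∑ n ∈ Finset.Icc 1 L, ∑ k ∈ n.divisors, F k (n / k)
      = ∑ m ∈ Finset.Icc 1 L, ∑ k ∈ Finset.Icc 1 (L / m), F k m := by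
  classical
  -- swap to the divisor `k` first
  have h1 : ∑ n ∈ Finset.Icc 1 L, ∑ k ∈ n.divisors, F k (n / k)
      = ∑ k ∈ Finset.Icc 1 L, ∑ n ∈ (Finset.Icc 1 L).filter (k ∣ ·), F k (n / k) := by
    refine Finset.sum_comm' fun n k => ?_
    simp only [Finset.mem_Icc, Nat.mem_divisors, Finset.mem_filter]
    constructor
    · rintro ⟨⟨hn1, hnL⟩, hkn, hn0⟩
      have hk := Nat.le_of_dvd (by omega) hkn
      have hk1 := Nat.pos_of_dvd_of_pos hkn (by omega)
      exact ⟨⟨⟨hn1, hnL⟩, hkn⟩, by omega, by omega⟩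
    · rintro ⟨⟨⟨hn1, hnL⟩, hkn⟩, hk1, hkL⟩
      exact ⟨⟨hn1, hnL⟩, hkn, by omega⟩
  -- the multiples of `k` in `[1, L]` are `k·[1, L/k]`
  have h2 : ∀ k ∈ Finset.Icc 1 L,
      ∑ n ∈ (Finset.Icc 1 L).filter (k ∣ ·), F k (n / k) = ∑ m ∈ Finset.Icc 1 (L / k), F k m := by
    intro k hk
    have hk1 : 1 ≤ k := (Finset.mem_Icc.mp hk).1
    have himage : (Finset.Icc 1 L).filter (k ∣ ·) = (Finset.Icc 1 (L / k)).image (k * ·) := by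
      ext n
      simp only [Finset.mem_filter, Finset.mem_Icc, Finset.mem_image]
      constructor
      · rintro ⟨⟨hn1, hnL⟩, m, rfl⟩
        refine ⟨m, ⟨?_, ?_⟩, rfl⟩
        · rcases Nat.eq_zero_or_pos m with rfl | hm
          · simp at hn1
          · exact hm
        · exact (Nat.le_div_iff_mul_le hk1).mpr (by rw [Nat.mul_comm]; exact hnL)
      · rintro ⟨m, ⟨hm1, hmL⟩, rfl⟩
        refine ⟨⟨?_, ?_⟩, dvd_mul_right k m⟩
        · exact Nat.le_mul_of_pos_right k hm1 |>.trans' hk1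
        · have := (Nat.le_div_iff_mul_le hk1).mp hmL
          rw [Nat.mul_comm]; exact this
    rw [himage, Finset.sum_image fun a _ b _ hab => Nat.eq_of_mul_eq_mul_left hk1 hab]
    refine Finset.sum_congr rfl fun m _ => ?_
    rw [Nat.mul_div_cancel_left m hk1]
  rw [h1, Finset.sum_congr rfl h2]
  -- swap back
  refine Finset.sum_comm' fun k m => ?_
  simp only [Finset.mem_Icc]
  constructor
  · rintro ⟨⟨hk1, hkL⟩, hm1, hmL⟩
    have hkm : m * k ≤ L := (Nat.le_div_iff_mul_le hk1).mp hmL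
    refine ⟨⟨hk1, (Nat.le_div_iff_mul_le hm1).mpr (by rw [Nat.mul_comm]; exact hkm)⟩, hm1, ?_⟩
    exact le_trans (Nat.le_mul_of_pos_right m hk1) hkm
  · rintro ⟨⟨hk1, hkL⟩, hm1, hmL⟩
    have hkm : k * m ≤ L := (Nat.le_div_iff_mul_le hm1).mp hkL
    refine ⟨⟨hk1, le_trans (Nat.le_mul_of_pos_right k hm1) hkm⟩, hm1,
      (Nat.le_div_iff_mul_le hk1).mpr (by rw [Nat.mul_comm]; exact hkm)⟩

/-- Weighted AM–GM: `2AB ≤ gA² + B²/g` for `g > 0`. [folklore] -/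
private theorem two_mul_le_of_pos {g : ℝ} (hg : 0 < g) (A B : ℝ) :
    2 * A * B ≤ g * A ^ 2 + B ^ 2 / g := by
  rw [← sub_nonneg]
  have : g * A ^ 2 + B ^ 2 / g - 2 * A * B = (g * A - B) ^ 2 / g := by
    field_simp; ring
  rw [this]; positivity

/-- **(P1)** Soundararajan's inequality termwise (IKT §6, first display): with
`g(k) = √W/(h √k log k)`,
`2·|Λ(k)/(√k log k)·sin((h/2) log k)|·|f(m)|·|f(km)| ≤ √W·Λ(k) sin²((h/2)log k)/(h k log² k)·|f(m)|² + (h/√W)·Λ(k)·|f(km)|²`.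
[folklore] -/
private theorem two_mul_term_le {h W : ℝ} (hh : 0 < h) (hW : 0 < W) (k : ℕ) (a b : ℝ) :
    2 * (|Λ k / (Real.sqrt k * Real.log k) * Real.sin (h / 2 * Real.log k)| * a * b)
      ≤ Real.sqrt W * (Real.sin (h / 2 * Real.log k) ^ 2 / (h * k * Real.log k ^ 2) * Λ k) * a ^ 2
        + h / Real.sqrt W * Λ k * b ^ 2 := by
  by_cases hΛ : Λ k = 0
  · simp [hΛ]
  -- `Λ k ≠ 0` forces `k ≥ 2`
  have hk2 : 2 ≤ k := by
    by_contra hlt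
    push Not at hlt
    interval_cases k <;> simp [ArithmeticFunction.vonMangoldt_apply_one] at hΛ
  have hk0 : (0 : ℝ) < k := by exact_mod_cast (show 0 < k by omega)
  have hl : 0 < Real.log k := Real.log_pos (by exact_mod_cast (show 1 < k by omega))
  have hκ : 0 < Real.sqrt k := Real.sqrt_pos.mpr hk0
  have hκ2 : Real.sqrt k * Real.sqrt k = k := Real.mul_self_sqrt hk0.le
  have hΛ0 : 0 < Λ k := lt_of_le_of_ne ArithmeticFunction.vonMangoldt_nonneg (Ne.symm hΛ)
  have hsW : 0 < Real.sqrt W := Real.sqrt_pos.mpr hW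
  set s := Real.sin (h / 2 * Real.log k) with hs
  set ℓ := Real.log k with hℓ
  set κ := Real.sqrt k with hκdef
  have habs : |Λ k / (κ * ℓ) * s| = Λ k / (κ * ℓ) * |s| := by
    rw [abs_mul, abs_of_pos (by positivity)]
  rw [habs]
  have hg : 0 < Real.sqrt W / (h * κ * ℓ) := by positivity
  have key := two_mul_le_of_pos hg (|s| * a) b
  have hmul := mul_le_mul_of_nonneg_left key (le_of_lt (by positivity : 0 < Λ k / (κ * ℓ)))
  have lhs : Λ k / (κ * ℓ) * (2 * (|s| * a) * b) = 2 * (Λ k / (κ * ℓ) * |s| * a * b) := by ring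
  have rhs : Λ k / (κ * ℓ) * (Real.sqrt W / (h * κ * ℓ) * (|s| * a) ^ 2 + b ^ 2 / (Real.sqrt W / (h * κ * ℓ)))
      = Real.sqrt W * (s ^ 2 / (h * k * ℓ ^ 2) * Λ k) * a ^ 2 + h / Real.sqrt W * Λ k * b ^ 2 := by
    rw [mul_pow, sq_abs, ← hκ2]
    field_simp
  linarith [hmul, lhs, rhs]

/-- The triangle inequality for the bilinear form:
`‖moForm f L h‖ ≤ (2/π) Σ_{n ≤ L} Σ_{k ∣ n} |Λ(k) sin((h/2)log k)/(√k log k)|·|f(n/k)|·|f(n)|`. [folklore] -/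
private theorem norm_moForm_le (f : ℕ → ℂ) (L : ℕ) (h : ℝ) :
    ‖InoueKobayashiToma2025.moForm f L h‖
      ≤ 2 / π * ∑ n ∈ Finset.Icc 1 L, ∑ k ∈ n.divisors,
          |Λ k / (Real.sqrt k * Real.log k) * Real.sin (h / 2 * Real.log k)| * ‖f (n / k)‖ * ‖f n‖ := by
  unfold InoueKobayashiToma2025.moForm
  have h2π : ‖(2 / π : ℂ)‖ = 2 / π := by
    rw [norm_div, Complex.norm_real, Real.norm_of_nonneg Real.pi_pos.le]
    simp
  rw [norm_mul, h2π]
  gcongr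
  refine (norm_sum_le _ _).trans (Finset.sum_le_sum fun n _ => ?_)
  refine (norm_sum_le _ _).trans (Finset.sum_le_sum fun k _ => ?_)
  rw [norm_mul, norm_mul, Complex.norm_real, RCLike.norm_conj, Real.norm_eq_abs]

/-- **(P1)+(P2)**: the bilinear form is dominated by the weighted diagonal sums (IKT §6, first and
second displays): `|Re moForm| ≤ (1/π) Σ_{m ≤ L} |f(m)|² (√W·S_h(L/m) + (h/√W) log m)` with
`S_h(M) = Σ_{1 ≤ k ≤ M} Λ(k) sin²((h/2)log k)/(h k log² k)`. [folklore] -/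
private theorem abs_re_moForm_le {h W : ℝ} (hh : 0 < h) (hW : 0 < W) (f : ℕ → ℂ) (L : ℕ) :
    |(InoueKobayashiToma2025.moForm f L h).re|
      ≤ ∑ m ∈ Finset.Icc 1 L, ‖f m‖ ^ 2 * (1 / π *
          (Real.sqrt W * ∑ k ∈ Finset.Icc 1 (L / m),
              Real.sin (h / 2 * Real.log k) ^ 2 / (h * k * Real.log k ^ 2) * Λ k
            + h / Real.sqrt W * Real.log m)) := by
  refine (Complex.abs_re_le_norm _).trans ((norm_moForm_le f L h).trans ?_)
  -- termwise AM–GM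
  have hterm : ∀ n ∈ Finset.Icc 1 L, ∀ k ∈ n.divisors,
      2 * (|Λ k / (Real.sqrt k * Real.log k) * Real.sin (h / 2 * Real.log k)| * ‖f (n / k)‖ * ‖f n‖)
        ≤ Real.sqrt W * (Real.sin (h / 2 * Real.log k) ^ 2 / (h * k * Real.log k ^ 2) * Λ k)
            * ‖f (n / k)‖ ^ 2 + h / Real.sqrt W * Λ k * ‖f n‖ ^ 2 :=
    fun n _ k _ => two_mul_term_le hh hW k _ _
  have hsum : 2 / π * ∑ n ∈ Finset.Icc 1 L, ∑ k ∈ n.divisors,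
        |Λ k / (Real.sqrt k * Real.log k) * Real.sin (h / 2 * Real.log k)| * ‖f (n / k)‖ * ‖f n‖
      ≤ 1 / π * ∑ n ∈ Finset.Icc 1 L, ∑ k ∈ n.divisors,
        (Real.sqrt W * (Real.sin (h / 2 * Real.log k) ^ 2 / (h * k * Real.log k ^ 2) * Λ k)
            * ‖f (n / k)‖ ^ 2 + h / Real.sqrt W * Λ k * ‖f n‖ ^ 2) := by
    rw [show (2 : ℝ) / π = 1 / π * 2 by ring, mul_assoc, Finset.mul_sum]
    gcongr with n hn
    rw [Finset.mul_sum]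
    exact Finset.sum_le_sum fun k hk => hterm n hn k hk
  refine hsum.trans (le_of_eq ?_)
  -- split the double sum and reindex the first half
  have hre := sum_divisors_reindex L (fun k m =>
    Real.sqrt W * (Real.sin (h / 2 * Real.log k) ^ 2 / (h * k * Real.log k ^ 2) * Λ k) * ‖f m‖ ^ 2)
  have hlog : ∀ n ∈ Finset.Icc 1 L,
      ∑ k ∈ n.divisors, h / Real.sqrt W * Λ k * ‖f n‖ ^ 2
        = h / Real.sqrt W * Real.log n * ‖f n‖ ^ 2 := by
    intro n _
    rw [← Finset.sum_mul, ← Finset.mul_sum, ArithmeticFunction.vonMangoldt_sum]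
  have hsplit : ∑ n ∈ Finset.Icc 1 L, ∑ k ∈ n.divisors,
        (Real.sqrt W * (Real.sin (h / 2 * Real.log k) ^ 2 / (h * k * Real.log k ^ 2) * Λ k)
            * ‖f (n / k)‖ ^ 2 + h / Real.sqrt W * Λ k * ‖f n‖ ^ 2)
      = (∑ m ∈ Finset.Icc 1 L, ∑ k ∈ Finset.Icc 1 (L / m),
          Real.sqrt W * (Real.sin (h / 2 * Real.log k) ^ 2 / (h * k * Real.log k ^ 2) * Λ k)
            * ‖f m‖ ^ 2)
        + ∑ n ∈ Finset.Icc 1 L, h / Real.sqrt W * Real.log n * ‖f n‖ ^ 2 := by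
    rw [← hre, ← Finset.sum_congr rfl hlog, ← Finset.sum_add_distrib]
    exact Finset.sum_congr rfl fun n _ => Finset.sum_add_distrib
  rw [hsplit, mul_add, Finset.mul_sum, Finset.mul_sum, ← Finset.sum_add_distrib]
  refine Finset.sum_congr rfl fun m _ => ?_
  rw [← Finset.sum_mul, ← Finset.mul_sum]
  ring


end IKT3

/-- **Inoue–Kobayashi–Toma 2025, Theorem 3 — PROVED** (the Montgomery–Odlyzko-method limitation
inequality, UNCONDITIONAL): for every `W > 0` there are `C` and `L₀` such that for all `L ≥ L₀`,
`h > 0` and `f` not identically zero on `[1, L]`, for some real `l ∈ [1, L]`,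
`|Re moForm f L h| / Σ_{n ≤ L}|f(n)|² ≤ (√W/2) φ((h/2π) log(L/l)) + h log l/(π√W) + C h`.
The proof is the printed one (§6): Soundararajan's termwise AM–GM with `g(k) = √W/(h√k log k)`,
the reindexing `km = n` with `Σ_{k ∣ n} Λ(k) = log n`, the prime-number-theorem estimate
`Σ_{k ≤ x} Λ(k) sin²((h/2)log k)/(h k log² k) ≤ (π/2) φ((h/2π) log x) + O(h)` (partial summation
against `ψ(x) = x + O(x/log² x)`, the tree's `chebyshevPsi_sub_self_isBigO_div_logPow`), and the
maximum over `l = n ≤ L`; here `C = √W·C₁/π` with `C₁` the absolute constant of that estimate and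
`L₀ = 1`. Discharges the named fact `inoueKobayashiToma2025_theorem3` (`ZetaGapRecordsRH.lean`).
[cite: InoueKobayashiToma2025, Theorem 3 (p. 4; proof §6)] -/
theorem inoueKobayashiToma2025_theorem3_holds :
    Literature.NumberTheory.LFunctions.inoueKobayashiToma2025_theorem3 := by
  intro W hW
  obtain ⟨C₁, hC₁0, hC₁⟩ := IKT3.exists_primeSum_le
  refine ⟨Real.sqrt W * C₁ / π, 1, fun L hL h hh f hN => ?_⟩
  set N := ∑ n ∈ Finset.Icc 1 L, ‖f n‖ ^ 2 with hNdef
  have hN0 : 0 < N := lt_of_le_of_ne (Finset.sum_nonneg fun _ _ => by positivity) (Ne.symm hN)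
  have hsW : 0 < Real.sqrt W := Real.sqrt_pos.mpr hW
  -- the bound at level `m`, for `l = m`
  set B : ℕ → ℝ := fun m =>
    Real.sqrt W / 2 * InoueKobayashiToma2025.phi (h / (2 * π) * Real.log ((L : ℝ) / (m : ℕ)))
      + h * Real.log (m : ℕ) / (π * Real.sqrt W) + Real.sqrt W * C₁ / π * h with hBdef
  obtain ⟨m, hm, hmax⟩ :=
    Finset.exists_max_image (Finset.Icc 1 L) B ⟨1, Finset.mem_Icc.mpr ⟨le_rfl, hL⟩⟩
  have hm1 : 1 ≤ m := (Finset.mem_Icc.mp hm).1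
  have hmL : m ≤ L := (Finset.mem_Icc.mp hm).2
  refine ⟨m, by exact_mod_cast hm1, by exact_mod_cast hmL, ?_⟩
  rw [div_le_iff₀ hN0]
  -- step 1: (P1)+(P2)
  have h12 := IKT3.abs_re_moForm_le hh hW f L
  -- step 2: (P3) at `x = L/m'` for each `m' ≤ L`
  have h3 : ∀ m' ∈ Finset.Icc 1 L,
      ∑ k ∈ Finset.Icc 1 (L / m'),
          Real.sin (h / 2 * Real.log k) ^ 2 / (h * k * Real.log k ^ 2) * Λ k
        ≤ π / 2 * InoueKobayashiToma2025.phi (h / (2 * π) * Real.log ((L : ℝ) / (m' : ℕ)))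
          + C₁ * h := by
    intro m' hm'
    have hm'1 : 1 ≤ m' := (Finset.mem_Icc.mp hm').1
    have hm'L : m' ≤ L := (Finset.mem_Icc.mp hm').2
    have hx : (1 : ℝ) ≤ (L : ℝ) / (m' : ℕ) := by
      rw [le_div_iff₀ (by exact_mod_cast (show 0 < m' by omega))]
      simpa using (show (m' : ℝ) ≤ L by exact_mod_cast hm'L)
    have key := hC₁ h hh ((L : ℝ) / (m' : ℕ)) hx
    have hfl : ⌊(L : ℝ) / (m' : ℕ)⌋₊ = L / m' := by
      rw [Nat.floor_div_natCast, Nat.floor_natCast]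
    rw [hfl] at key
    have h0 : ∑ k ∈ Finset.Icc 0 (L / m'),
        Real.sin (h / 2 * Real.log k) ^ 2 / (h * k * Real.log k ^ 2) * Λ k
      = ∑ k ∈ Finset.Icc 1 (L / m'),
        Real.sin (h / 2 * Real.log k) ^ 2 / (h * k * Real.log k ^ 2) * Λ k := by
      rw [← Finset.add_sum_Ioc_eq_sum_Icc (Nat.zero_le _), ← Finset.Icc_add_one_left_eq_Ioc]
      simp
    rwa [h0] at key
  -- step 3: combine, bounding each level by the maximal one
  have hlevel : ∀ m' ∈ Finset.Icc 1 L,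
      ‖f m'‖ ^ 2 * (1 / π *
          (Real.sqrt W * ∑ k ∈ Finset.Icc 1 (L / m'),
              Real.sin (h / 2 * Real.log k) ^ 2 / (h * k * Real.log k ^ 2) * Λ k
            + h / Real.sqrt W * Real.log m'))
        ≤ ‖f m'‖ ^ 2 * B m := by
    intro m' hm'
    refine mul_le_mul_of_nonneg_left ?_ (by positivity)
    refine le_trans ?_ (hmax m' hm')
    have := h3 m' hm'
    simp only [hBdef]
    have hid : 1 / π * (Real.sqrt W * (π / 2 *
          InoueKobayashiToma2025.phi (h / (2 * π) * Real.log ((L : ℝ) / (m' : ℕ))) + C₁ * h)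
        + h / Real.sqrt W * Real.log m')
      = Real.sqrt W / 2 * InoueKobayashiToma2025.phi (h / (2 * π) * Real.log ((L : ℝ) / (m' : ℕ)))
        + h * Real.log (m' : ℕ) / (π * Real.sqrt W) + Real.sqrt W * C₁ / π * h := by
      field_simp
      ring
    rw [← hid]
    gcongr
  calc |(InoueKobayashiToma2025.moForm f L h).re|
      ≤ ∑ m' ∈ Finset.Icc 1 L, ‖f m'‖ ^ 2 * (1 / π *
          (Real.sqrt W * ∑ k ∈ Finset.Icc 1 (L / m'),
              Real.sin (h / 2 * Real.log k) ^ 2 / (h * k * Real.log k ^ 2) * Λ k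
            + h / Real.sqrt W * Real.log m')) := h12
    _ ≤ ∑ m' ∈ Finset.Icc 1 L, ‖f m'‖ ^ 2 * B m := Finset.sum_le_sum hlevel
    _ = B m * N := by rw [hNdef, Finset.mul_sum]; exact Finset.sum_congr rfl fun _ _ => mul_comm _ _
    _ = _ := by simp only [hBdef]

end Literature.NumberTheory.LFunctions
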